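import Literature.AlgebraicGeometry.ShimuraVarieties.UnitaryShimuraPiecesUnderHeckeTranslate
import Literature.AlgebraicGeometry.ShimuraVarieties.UnitaryShimuraHeckeTranslateIso
import HarnessLib

/-!
# Reduction to the IDENTITY piece: a class non-zero on some piece of `(M_{K″})_τ` becomes, after one conjugate-level isomorphism,
# non-zero on the identity piece ([Deligne1979ShimuraVarieties] 2.1.2–2.1.4; [Milne2005ShimuraVarieties] Lemma 5.13, Thm. 13.6)

Topic `AlgebraicGeometry/ShimuraVarieties`; namespaces `Literature.NumberTheory.Automorphic.UnitaryGroup.ShimuraSet` (§1, point/coset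
algebra) and `Literature.AlgebraicGeometry.ShimuraVarieties.UnitaryCanonicalModel` (§2–§3, the rank-3 ★ `RecordSystem`).  PROOF FILE:
theorems only — no definition, no named fact, no instance, no `sorry`.

The (β′) device of the GS programme (cell `hodgecm-mathlib`, crux `HLiu418` 24832, A-plan2's memo `GS-PROGRAMME.md` A.13 ADDENDUM 2, node
(7d)): the pinned seesaw source reaches, at a level `Λ`, only the IDENTITY piece `[1]_Λ` of `(M_Λ)_τ = ⨆_q Γ_{g_q}∖𝔹²`; a class living on
another piece `[b]_{K″}` is moved there by the Hecke translate `T_b : M_Λ ⟶ M_{K″}`, `Λ = bK″b⁻¹`, which is an ISOMORPHISM of levels when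
`bK″b⁻¹ ⊆ K₀` (★ `RecordSystem.exists_iso_heckeLevel`, file `UnitaryShimuraHeckeTranslateIso.lean`, L2) and maps `[1]_Λ` onto `[b]_{K″}`
(★ `RecordSystem.image_baseChange_heckeTranslate_range_piece` / `exists_pieceIso_of_heckeTranslateIso`, file
`UnitaryShimuraPiecesUnderHeckeTranslate.lean`, L1/L3).  This file supplies the three remaining bookkeeping steps:

* §1 `ShimuraSet.mk_pt_mul_eq_of_mk_pt_eq_of_heckeLE` — right translation by `b` DESCENDS on the index sets, `Ξ_Λ → Ξ_K`, `[a] ↦ [ab]`,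
  whenever `b⁻¹ Λ b ⊆ K` (★ `C5.HeckeLE b Λ K`; [Milne2005ShimuraVarieties] §5 p. 58 L6–11 «`T(g)` acts on points as `[x,a] ↦ [x,ag]`»);
* §2 `exists_conj_rep_of_normalised` — from the output of ★ L4 `C5.exists_smallLevel_le_normalised_conj_le` (`K″` normalised by `K′`,
  representatives `g_q` of `Ξ_{K′}` with `g_q K″ g_q⁻¹ ⊆ K₀`), EVERY class of `Ξ_{K″}` has a representative `b` with `bK″b⁻¹ ⊆ K₀` — the
  hypothesis `hb` of ★ L2 (`b := γ⁻¹a″ = g_q k′`, ★ `C5.conj_mem_of_normalised`);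
* §3 **`RecordSystem.complexBetti_map_identityPiece_ne_zero_of_heckeTranslateIso`** — for an isomorphism of levels `e : M_Λ ≅ M_{K″}` whose
  `e.hom` is a `b`-translate with `b⁻¹Λb ⊆ K″`, a `K″`-piece through any representative of `[b]_{K″}` and a `Λ`-piece through any
  representative of the identity class `[1]_Λ` (legs of colimit cofans carrying ball data with `Hℂ = H^τ` and the `pieces` clause — the
  shape of ★ `HComp.RecordSystem.exists_pieces_fieldRange`): on `Hⁿ((M_{K″})_τ(ℂ); ℂ)`, `x|_{[b]} ≠ 0 ⇒ ((e.hom)_τ^* x)|_{[1]_Λ} ≠ 0`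
  (★ L3 + §1 at `a₀ = 1`).

With ★ L4, ★ L2, ★ GS-7a/(7c-rec) and the cofan detection `complexBetti_eq_zero_of_forall_map_inj`, the (7d) step of the GS-7 clause-(1)
closer is three `obtain`s.  HC_CM is NOT proved here; nothing in this file discharges a printed-citation binder by itself.

## References
* [Deligne1979ShimuraVarieties] P. Deligne, *Variétés de Shimura* (1979), 2.1.2–2.1.4 (Milne's translation, PDF p. 24).
* [Milne2005ShimuraVarieties] J. S. Milne, *Introduction to Shimura varieties* (rev. 2017): Lemma 5.13 p. 57, §5 p. 58 L6–11, §13 Thm. 13.6 p. 118 L21–28.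
* [GortzWedhorn2020] U. Görtz, T. Wedhorn, *Algebraic Geometry I* (2nd ed.), §(3.5) Example 3.11 (coproducts of schemes).
-/

set_option autoImplicit false

noncomputable section

open Function MulAction Topology NumberField CategoryTheory CategoryTheory.Limits Matrix AlgebraicGeometry
open scoped Matrix ComplexOrder
open Literature.AlgebraicGeometry.Motives
open Literature.NumberTheory.Automorphic Literature.NumberTheory.Automorphic.UnitaryGroup
open Literature.NumberTheory.Automorphic.Liu2021.AppendixC (C5.OpenCompactSubgroup C5.SmallLevel)
open Literature.Geometry.ComplexHyperbolic Literature.Geometry.ComplexHyperbolic.BallModel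
open Literature.NumberTheory.Automorphic.ShimuraDissection

/-! ## §1 Right translation by `b` descends on the index sets `Ξ_Λ → Ξ_K` -/

namespace Literature.NumberTheory.Automorphic.UnitaryGroup.ShimuraSet

variable (L : Type) [Field L] [NumberField L] [IsCMField L] (H : Matrix (Fin 3) (Fin 3) L)

/-- **`[a]_Λ = [a₀]_Λ ⇒ [ab]_K = [a₀b]_K` whenever `b⁻¹Λb ⊆ K`**: if `a = γ a₀ l` with `γ ∈ U(H)(L⁺)`, `l ∈ Λ`, then `ab = γ (a₀b) (b⁻¹lb)` with
`b⁻¹lb ∈ K` — right translation by `b` descends `U(H)(L⁺)∖U(H)(𝔸_{L⁺,f})/Λ → U(H)(L⁺)∖U(H)(𝔸_{L⁺,f})/K` (the index-set shadow of «`T(g)`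
acts on points as `[x,a] ↦ [x,ag]`»). [cite: Milne2005ShimuraVarieties, §5 p. 58 L6–11 and Lemma 5.13 p. 57] [cite: Deligne1979ShimuraVarieties, 2.1.4] -/
theorem mk_pt_mul_eq_of_mk_pt_eq_of_heckeLE
    (Λ K : Subgroup (finAdelic (↥(maximalRealSubfield L)) L (IsCMField.complexConj L) 3 H))
    {b : finAdelic (↥(maximalRealSubfield L)) L (IsCMField.complexConj L) 3 H} (hb : ∀ l ∈ Λ, b⁻¹ * l * b ∈ K)
    {a a₀ : finAdelic (↥(maximalRealSubfield L)) L (IsCMField.complexConj L) 3 H}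
    (h : (Quotient.mk'' (CosetSpace.pt (rationalToFinAdelic _ L _ 3 H) Λ a) :
        orbitRel.Quotient (rational (↥(maximalRealSubfield L)) L (IsCMField.complexConj L) 3 H)
          (CosetSpace (rationalToFinAdelic (↥(maximalRealSubfield L)) L (IsCMField.complexConj L) 3 H) Λ)) =
      Quotient.mk'' (CosetSpace.pt (rationalToFinAdelic _ L _ 3 H) Λ a₀)) :
    (Quotient.mk'' (CosetSpace.pt (rationalToFinAdelic _ L _ 3 H) K (a * b)) :
        orbitRel.Quotient (rational (↥(maximalRealSubfield L)) L (IsCMField.complexConj L) 3 H)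
          (CosetSpace (rationalToFinAdelic (↥(maximalRealSubfield L)) L (IsCMField.complexConj L) 3 H) K)) =
      Quotient.mk'' (CosetSpace.pt (rationalToFinAdelic _ L _ 3 H) K (a₀ * b)) := by
  -- `γ • pt_Λ a₀ = pt_Λ a`, i.e. `l := (γ a₀)⁻¹ a ∈ Λ`
  obtain ⟨γ, hγ⟩ := (Quotient.eq''.trans mem_orbit_iff).mp h
  rw [CosetSpace.smul_pt, CosetSpace.pt_eq_pt_iff] at hγ
  -- `γ • pt_K (a₀ b) = pt_K (a b)`: `(γ a₀ b)⁻¹ (a b) = b⁻¹ l b ∈ K`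
  refine (Quotient.eq''.trans mem_orbit_iff).mpr ⟨γ, ?_⟩
  rw [CosetSpace.smul_pt, CosetSpace.pt_eq_pt_iff]
  have e : (rationalToFinAdelic _ L _ 3 H γ * (a₀ * b))⁻¹ * (a * b) =
      b⁻¹ * ((rationalToFinAdelic _ L _ 3 H γ * a₀)⁻¹ * a) * b := by group
  rw [e]
  exact hb _ hγ

/-- **Every class of `Ξ_{K″}` has a representative `b` with `bK″b⁻¹ ⊆ K₀`, given the (L4) shrink**: for `K″` normalised by `K′` (the inclusion `K″ ≤ K′` is not needed) and
representatives `g_q` of `Ξ_{K′}` with `g_q K″ g_q⁻¹ ⊆ K₀` (the output of ★ `C5.exists_smallLevel_le_normalised_conj_le`), write `a″ = γ g_q k′`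
(`γ ∈ U(H)(L⁺)`, `k′ ∈ K′`; `q` the `K′`-class of `a″`); then `b := g_q k′ = γ⁻¹a″` represents the `K″`-class of `a″` and `bK″b⁻¹ = g_q K″ g_q⁻¹ ⊆ K₀`
(★ `C5.conj_mem_of_normalised`) — the hypothesis `hb` of the conjugate-level isomorphism ★ `RecordSystem.exists_iso_heckeLevel`.
[cite: Milne2005ShimuraVarieties, Lemma 5.13 p. 57 and §13 p. 118 L21–26] [cite: Deligne1979ShimuraVarieties, 2.1.2] -/
theorem exists_conj_rep_of_normalised
    {K₀ : C5.OpenCompactSubgroup ↥(finAdelic (↥(maximalRealSubfield L)) L (IsCMField.complexConj L) 3 H)}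
    {K' K'' : C5.SmallLevel K₀}
    (hnorm : ∀ k ∈ K'.1.1, ∀ n ∈ K''.1.1, k⁻¹ * n * k ∈ K''.1.1)
    (g : orbitRel.Quotient (rational (↥(maximalRealSubfield L)) L (IsCMField.complexConj L) 3 H)
          (CosetSpace (rationalToFinAdelic (↥(maximalRealSubfield L)) L (IsCMField.complexConj L) 3 H) K'.1.1) →
        finAdelic (↥(maximalRealSubfield L)) L (IsCMField.complexConj L) 3 H)
    (hg : ∀ q, Quotient.mk'' (CosetSpace.pt (rationalToFinAdelic _ L _ 3 H) K'.1.1 (g q)) = q)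
    (hg0 : ∀ q, ∀ n ∈ K''.1.1, g q * n * (g q)⁻¹ ∈ K₀.1)
    (a'' : finAdelic (↥(maximalRealSubfield L)) L (IsCMField.complexConj L) 3 H) :
    ∃ b : finAdelic (↥(maximalRealSubfield L)) L (IsCMField.complexConj L) 3 H,
      (∀ y ∈ K''.1.1, b * y * b⁻¹ ∈ K₀.1) ∧
        (Quotient.mk'' (CosetSpace.pt (rationalToFinAdelic _ L _ 3 H) K''.1.1 b) :
            orbitRel.Quotient (rational (↥(maximalRealSubfield L)) L (IsCMField.complexConj L) 3 H)
              (CosetSpace (rationalToFinAdelic (↥(maximalRealSubfield L)) L (IsCMField.complexConj L) 3 H) K''.1.1)) =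
          Quotient.mk'' (CosetSpace.pt (rationalToFinAdelic _ L _ 3 H) K''.1.1 a'') := by
  -- the `K′`-class of `a″` and its representative `g_q`: `γ • pt_{K′} a″ = pt_{K′} (g q)`, i.e. `k′ := (γ a″)⁻¹ (g q) ∈ K′`
  set q := (Quotient.mk'' (CosetSpace.pt (rationalToFinAdelic _ L _ 3 H) K'.1.1 a'') :
    orbitRel.Quotient (rational (↥(maximalRealSubfield L)) L (IsCMField.complexConj L) 3 H)
      (CosetSpace (rationalToFinAdelic (↥(maximalRealSubfield L)) L (IsCMField.complexConj L) 3 H) K'.1.1)) with hq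
  obtain ⟨γ, hγ⟩ := (Quotient.eq''.trans mem_orbit_iff).mp (hg q)
  -- hγ : γ • pt_{K′} a″ = pt_{K′} (g q)
  rw [CosetSpace.smul_pt, CosetSpace.pt_eq_pt_iff] at hγ
  -- `b := γ a″ = g_q k′⁻¹` with `k′ := (γ a″)⁻¹ g_q ∈ K′`
  refine ⟨rationalToFinAdelic _ L _ 3 H γ * a'', ?_, ?_⟩
  · have e : rationalToFinAdelic _ L _ 3 H γ * a'' = g q * ((rationalToFinAdelic _ L _ 3 H γ * a'')⁻¹ * g q)⁻¹ := by group
    rw [e]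
    exact Liu2021.AppendixC.C5.conj_mem_of_normalised (K'.1.1.inv_mem hγ) hnorm (hg0 q)
  · exact (Quotient.eq''.trans mem_orbit_iff).mpr ⟨γ, by rw [CosetSpace.smul_pt]⟩

end Literature.NumberTheory.Automorphic.UnitaryGroup.ShimuraSet

/-! ## §2 The identity piece after a conjugate-level isomorphism -/

namespace Literature.AlgebraicGeometry.ShimuraVarieties.UnitaryCanonicalModel

variable {L : Type} [Field L] [NumberField L] [IsCMField L] {H : Matrix (Fin 3) (Fin 3) L}
  {τ : L →+* ℂ} {T : GL (Fin 3) ℂ} {hT : formCongr (starRingEnd ℂ) T (H.map τ) = BallModel.J}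
  {K₀ : C5.OpenCompactSubgroup ↥(finAdelic (↥(maximalRealSubfield L)) L (IsCMField.complexConj L) 3 H)}

namespace RecordSystem

/-- **Reduction to the identity piece.**  Let `e : M_Λ ≅ M_{K″}` be an isomorphism of levels whose `e.hom` is a `b`-translate with
`b⁻¹Λb ⊆ K″` (★ `RecordSystem.exists_iso_heckeLevel` at `Λ = bK″b⁻¹ ∩ K₀`, ★ `C5.heckeLE_heckeLevel`), let `ι″ : Y″ ⟶ (M_{K″})_τ` be the piece
through any representative `a″` of the class `[b]_{K″}` and `ι : Y ⟶ (M_Λ)_τ` the piece through any representative `a` of the IDENTITY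
class `[1]_Λ` (legs of colimit cofans whose summands carry ball data with `Hℂ = H^τ` and the `pieces` clause).  Then on `Hⁿ((M_{K″})_τ(ℂ); ℂ)`:
`x|_{Y″} ≠ 0 ⇒ ((e.hom)_τ^* x)|_{Y} ≠ 0` — the class has been moved to the identity piece of the conjugate level.
[cite: Milne2005ShimuraVarieties, Thm. 13.6 p. 118 L21–28 and Lemma 5.13 p. 57] [cite: Deligne1979ShimuraVarieties, 2.1.2–2.1.4]
[cite: GortzWedhorn2020, §(3.5) Example 3.11] -/
theorem complexBetti_map_identityPiece_ne_zero_of_heckeTranslateIso (S : RecordSystem L H τ T hT K₀)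
    {Λ K'' : C5.SmallLevel K₀} {b : finAdelic (↥(maximalRealSubfield L)) L (IsCMField.complexConj L) 3 H}
    (hbΛ : Liu2021.AppendixC.C5.HeckeLE b Λ K'')
    (e : S.M.obj Λ ≅ S.M.obj K'') (he : S.IsHeckeTranslate Λ K'' b e.hom)
    {Ξ Ξ'' : Type} {Y : Ξ → SchemeOver ℂ} (D : ∀ q, UnitaryBallUniformisationDatum 2 (Y q))
    {ι : ∀ q, Y q ⟶ (Motives.baseChangeHom τ).obj (S.M.obj Λ)}
    (hcol : IsColimit (Cofan.mk ((Motives.baseChangeHom τ).obj (S.M.obj Λ)) ι))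
    {Y'' : Ξ'' → SchemeOver ℂ} (D'' : ∀ q, UnitaryBallUniformisationDatum 2 (Y'' q))
    {ι'' : ∀ q, Y'' q ⟶ (Motives.baseChangeHom τ).obj (S.M.obj K'')}
    (hcol'' : IsColimit (Cofan.mk ((Motives.baseChangeHom τ).obj (S.M.obj K'')) ι''))
    (q₁ : Ξ) (hD : (D q₁).Hℂ = H.map τ) (a : finAdelic (↥(maximalRealSubfield L)) L (IsCMField.complexConj L) 3 H)
    (ha : (Quotient.mk'' (CosetSpace.pt (rationalToFinAdelic _ L _ 3 H) Λ.1.1 a) :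
        orbitRel.Quotient (rational (↥(maximalRealSubfield L)) L (IsCMField.complexConj L) 3 H)
          (CosetSpace (rationalToFinAdelic (↥(maximalRealSubfield L)) L (IsCMField.complexConj L) 3 H) Λ.1.1)) =
      Quotient.mk'' (CosetSpace.pt (rationalToFinAdelic _ L _ 3 H) Λ.1.1 1))
    (hι : letI : Algebra L ℂ := τ.toAlgebra
      ∀ z : Ball, AlgPoints.map (L := ℂ) (ι q₁) ((D q₁).unif ((T : Matrix (Fin 3) (Fin 3) ℂ) *ᵥ BallModel.lift z)) =
        AlgPoints.baseChangeEquiv τ (S.M.obj Λ) ((S.pts Λ).symm (ShimuraSet.mk L H τ T hT Λ.1.1 z a)))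
    (q'' : Ξ'') (hD'' : (D'' q'').Hℂ = H.map τ) (a'' : finAdelic (↥(maximalRealSubfield L)) L (IsCMField.complexConj L) 3 H)
    (ha'' : (Quotient.mk'' (CosetSpace.pt (rationalToFinAdelic _ L _ 3 H) K''.1.1 b) :
        orbitRel.Quotient (rational (↥(maximalRealSubfield L)) L (IsCMField.complexConj L) 3 H)
          (CosetSpace (rationalToFinAdelic (↥(maximalRealSubfield L)) L (IsCMField.complexConj L) 3 H) K''.1.1)) =
      Quotient.mk'' (CosetSpace.pt (rationalToFinAdelic _ L _ 3 H) K''.1.1 a''))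
    (hι'' : letI : Algebra L ℂ := τ.toAlgebra
      ∀ z : Ball, AlgPoints.map (L := ℂ) (ι'' q'') ((D'' q'').unif ((T : Matrix (Fin 3) (Fin 3) ℂ) *ᵥ BallModel.lift z)) =
        AlgPoints.baseChangeEquiv τ (S.M.obj K'') ((S.pts K'').symm (ShimuraSet.mk L H τ T hT K''.1.1 z a'')))
    (n : ℕ) {x : HodgeTheory.complexBetti ((Motives.baseChangeHom τ).obj (S.M.obj K'')) n}
    (hx : (HodgeTheory.complexBetti.map (ι'' q'') n).hom x ≠ 0) :
    (HodgeTheory.complexBetti.map (ι q₁) n).hom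
      ((HodgeTheory.complexBetti.map ((Motives.baseChangeHom τ).map e.hom) n).hom x) ≠ 0 := by
  -- `[a b]_{K″} = [1 b]_{K″} = [b]_{K″} = [a″]_{K″}`
  have hq : (Quotient.mk'' (CosetSpace.pt (rationalToFinAdelic _ L _ 3 H) K''.1.1 (a * b)) :
      orbitRel.Quotient (rational (↥(maximalRealSubfield L)) L (IsCMField.complexConj L) 3 H)
        (CosetSpace (rationalToFinAdelic (↥(maximalRealSubfield L)) L (IsCMField.complexConj L) 3 H) K''.1.1)) =
      Quotient.mk'' (CosetSpace.pt (rationalToFinAdelic _ L _ 3 H) K''.1.1 a'') := by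
    rw [ShimuraSet.mk_pt_mul_eq_of_mk_pt_eq_of_heckeLE L H Λ.1.1 K''.1.1 hbΛ ha, one_mul]
    exact ha''
  exact S.complexBetti_map_piece_ne_zero_of_heckeTranslateIso e he D hcol D'' hcol'' q₁ hD a hι q'' hD'' a'' hι'' hq n hx

end RecordSystem

end Literature.AlgebraicGeometry.ShimuraVarieties.UnitaryCanonicalModel

end
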